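import Mathlib
import HarnessLib
import Literature.Probability.Percolation.BlockResampling
import Literature.Probability.Percolation.InfiniteClusterDensity
import Literature.Probability.Percolation.TwoPointFunction
import Literature.Probability.Percolation.InequalitiesProofs
import Literature.Probability.Percolation.PercolationProofs
import Literature.Probability.Percolation.PercolationEvents
import Summits.CriticalPhenomena.PercolationContinuityZ3.Theorems.PercTreeValueTetrahedronHarrisGapStubCondHarris
import Summits.CriticalPhenomena.PercolationContinuityZ3.Theorems.PercTreeValueTetrahedronHarrisGapReduction
import Summits.CriticalPhenomena.PercolationContinuityZ3.Theorems.PercNearOneGluingNearOneGluingQ7ThreeCutAux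

/-!
# Crux `PercTreeValue.TetrahedronHarrisGap` (stmt-CriticalPhenomena-7799), line `noise_bridges`
# — stub `stub_noiseHarris` (N): noise keeps the Harris sign

Helper file for the crux skeleton `Cruxes/TetrahedronHarrisGap/Lines/noise_bridges.lean`,
`--supports stmt-CriticalPhenomena-7799`.  No new definitions; everything is stated in the tree's
vocabulary (`bondPercolation`, `resample`, `blockCondProb`, `armEdges`, `tau`, `openConn`).

**Statement.**  `P = bondPercolation (zdGraph 3) p_c`, `P_t = bondPercolation (zdGraph 3) t` (the noise
mask `M ∼ P_t`), `A = {0 ↔ a_r}`, `B = {b_r ↔ c_r}`, `W = armEdges (2r) 0` (a finite window of edges), and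
for `x = (ω, (ω', M))` the noised configuration `ω_t = resample (M ∩ W) (ω, ω')` (`ω'` on `M ∩ W`, `ω`
elsewhere).  Then `τ(0, a_r) τ(b_r, c_r) ≤ (P ⊗ (P ⊗ P_t)){ω ∈ A ∧ ω_t ∈ B}`.

**Proof.**  Everything is proved for an arbitrary countable graph `G`, parameters `p, q`, finite
window `W` and increasing measurable events `A, B`.
* For a FIXED finite block `K`, `(P ⊗ P){ω ∈ A ∧ resample K (ω, ω') ∈ B} = ∫ 𝟙_A(ω) P(B | ω off K) dP(ω)`
  (sections: `measureReal_prod_eq_integral`, `measureReal_setOf_resample_mem_section`, and the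
  definition of `blockCondProb`), and `∫ 𝟙_A · P(B | · off K) dP ≥ (∫ 𝟙_A)(∫ P(B | · off K)) = P(A) P(B)`
  by Harris–FKG for increasing square-integrable functions (`harris_fkg_integral_holds`; `𝟙_A` and
  `P(B | ω off K)` are increasing in `ω` because `A`, `B` are upper sets —
  `Q7ThreeCut.monotone_indicator_of_isUpperSet`, `CornerBall.blockCondProb_mono`) and the tower
  property `∫ P(B | ω off K) dP = P(B)` (`integral_blockCondProb_eq`).
* Fubini with the mask outermost: `(P ⊗ (P ⊗ P_q)) S = ∫⁻ M, (P ⊗ P){ω ∈ A ∧ resample (M ∩ W) (ω, ω') ∈ B} dP_q(M)`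
  (`Measure.prod_apply_symm` twice and `lintegral_prod_symm`); each integrand is `≥ P(A) P(B)` by the
  first bullet with `K = M ∩ W` (finite), and `P_q` is a probability measure.
* Measurability of the noised configuration `x ↦ resample (x.2.2 ∩ W) (x.1, x.2.1)`: membership of
  each edge is a Boolean combination of the three coordinates (`measurable_set_iff`).
-/

noncomputable section

open MeasureTheory
open Literature.Probability.Percolation Literature.Probability.LatticeModels

namespace Summit.CriticalPhenomena.PercolationContinuityZ3.Theorems.TetrahedronHarrisGap

section General

variable {V : Type*}

/-- The noised-configuration map `(ω, (ω', M)) ↦ resample (M ∩ W) (ω, ω')` is measurable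
(product σ-algebra): membership of an edge `e` is a Boolean combination of `e ∈ ω`, `e ∈ ω'`,
`e ∈ M`. -/
theorem measurable_resample_inter (W : Set (Sym2 V)) :
    Measurable fun x : BondConfig V × (BondConfig V × BondConfig V) =>
      resample (x.2.2 ∩ W) (x.1, x.2.1) := by
  refine measurable_set_iff.2 fun e => ?_
  have h : (fun x : BondConfig V × (BondConfig V × BondConfig V) =>
      e ∈ resample (x.2.2 ∩ W) (x.1, x.2.1)) =
      fun x => (e ∈ x.1 ∧ ¬(e ∈ x.2.2 ∧ e ∈ W)) ∨ (e ∈ x.2.1 ∧ (e ∈ x.2.2 ∧ e ∈ W)) := by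
    funext x
    exact propext mem_resample_iff
  rw [h]
  exact (((measurable_set_mem e).comp measurable_fst).and
      (((measurable_set_mem e).comp measurable_snd.snd).and measurable_const).not).or
    (((measurable_set_mem e).comp measurable_snd.fst).and
      (((measurable_set_mem e).comp measurable_snd.snd).and measurable_const))

variable (G : SimpleGraph V) (p : unitInterval)

/-- The indicator of a measurable event is square integrable. -/
theorem memLp_indicator_one {A : Set (BondConfig V)} (hAm : MeasurableSet A) :
    MemLp (A.indicator (1 : BondConfig V → ℝ)) 2 (bondPercolation G p) :=
  MemLp.of_bound (measurable_one.indicator hAm).aestronglyMeasurable 1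
    (ae_of_all _ fun ω => by rw [Real.norm_eq_abs]; exact abs_indicator_one_le A ω)

variable [Countable V]

/-- `P_p(E | ω off K)` is square integrable (measurable and `[0,1]`-valued). -/
theorem memLp_blockCondProb (K : Finset (Sym2 V)) {E : Set (BondConfig V)} (hE : MeasurableSet E) :
    MemLp (blockCondProb G p K E) 2 (bondPercolation G p) :=
  MemLp.of_bound (measurable_blockCondProb G p K hE).aestronglyMeasurable 1
    (ae_of_all _ fun ω => by rw [Real.norm_eq_abs]; exact abs_blockCondProb_le G p K E ω)

/-- **Sections of the resampled Harris event**: for every `ω`,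
`P_p{ω' | ω ∈ A ∧ resample K (ω, ω') ∈ B} = 𝟙_A(ω) · P_p(B | ω off K)`
(`measureReal_setOf_resample_mem_section` and the definition of `blockCondProb`). -/
theorem measureReal_section_mem_and_resample_mem (K : Finset (Sym2 V)) {A B : Set (BondConfig V)}
    (hBm : MeasurableSet B) (ω : BondConfig V) :
    (bondPercolation G p).real
        (Prod.mk ω ⁻¹' {x : BondConfig V × BondConfig V | x.1 ∈ A ∧ resample (↑K) x ∈ B}) =
      A.indicator (1 : BondConfig V → ℝ) ω * blockCondProb G p K B ω := by
  by_cases hω : ω ∈ A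
  · have hset : Prod.mk ω ⁻¹' {x : BondConfig V × BondConfig V | x.1 ∈ A ∧ resample (↑K) x ∈ B} =
        {ω' | resample (↑K) (ω, ω') ∈ B} := by
      ext ω'
      exact ⟨fun h => h.2, fun h => ⟨hω, h⟩⟩
    rw [hset, measureReal_setOf_resample_mem_section G p K hBm ω, Set.indicator_of_mem hω,
      Pi.one_apply, one_mul]
    rfl
  · have hset : Prod.mk ω ⁻¹' {x : BondConfig V × BondConfig V | x.1 ∈ A ∧ resample (↑K) x ∈ B} =
        ∅ := by
      ext ω'
      exact ⟨fun h => absurd h.1 hω, fun h => h.elim⟩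
    rw [hset, measureReal_empty, Set.indicator_of_notMem hω, zero_mul]

/-- **Harris after resampling a fixed finite block**: for increasing measurable `A, B` and a finite
block `K`, `P_p(A) P_p(B) ≤ (P_p ⊗ P_p){ω ∈ A ∧ resample K (ω, ω') ∈ B}`.  The right side is
`∫ 𝟙_A · P_p(B | · off K) dP_p` (sections), which dominates `(∫ 𝟙_A)(∫ P_p(B | · off K)) = P_p(A) P_p(B)`
by Harris–FKG for increasing functions and the tower property. -/
theorem measureReal_mul_le_measureReal_prod_resample (K : Finset (Sym2 V)) {A B : Set (BondConfig V)}
    (hA : IsUpperSet A) (hB : IsUpperSet B) (hAm : MeasurableSet A) (hBm : MeasurableSet B) :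
    (bondPercolation G p).real A * (bondPercolation G p).real B ≤
      ((bondPercolation G p).prod (bondPercolation G p)).real
        {x : BondConfig V × BondConfig V | x.1 ∈ A ∧ resample (↑K) x ∈ B} := by
  have hs : MeasurableSet {x : BondConfig V × BondConfig V | x.1 ∈ A ∧ resample (↑K) x ∈ B} :=
    (measurable_fst hAm).inter (measurable_resample _ hBm)
  rw [measureReal_prod_eq_integral G p hs]
  simp_rw [measureReal_section_mem_and_resample_mem G p K hBm]
  rw [← integral_indicator_one hAm, ← integral_blockCondProb_eq G p K hBm]
  exact harris_fkg_integral_holds G p (Q7ThreeCut.monotone_indicator_of_isUpperSet hA)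
    (CornerBall.blockCondProb_mono G p K hB) (memLp_indicator_one G p hAm)
    (memLp_blockCondProb G p K hBm)

variable (q : unitInterval)

omit [Countable V] in
/-- **Fubini with the noise mask outermost**: for the noised configuration
`ω_q = resample (M ∩ W) (ω, ω')`, `M ∼ P_q` independent of `(ω, ω') ∼ P_p ⊗ P_p`,
`(P_p ⊗ (P_p ⊗ P_q)){ω ∈ A ∧ ω_q ∈ B} = ∫⁻ (P_p ⊗ P_p){ω ∈ A ∧ resample (M ∩ W) (ω, ω') ∈ B} dP_q(M)`. -/
theorem measure_prod_mem_and_noised_mem_eq_lintegral (W : Set (Sym2 V)) {A B : Set (BondConfig V)}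
    (hAm : MeasurableSet A) (hBm : MeasurableSet B) :
    (bondPercolation G p).prod ((bondPercolation G p).prod (bondPercolation G q))
        {x : BondConfig V × (BondConfig V × BondConfig V) |
          x.1 ∈ A ∧ resample (x.2.2 ∩ W) (x.1, x.2.1) ∈ B} =
      ∫⁻ M, (bondPercolation G p).prod (bondPercolation G p)
          {x : BondConfig V × BondConfig V | x.1 ∈ A ∧ resample (M ∩ W) x ∈ B}
        ∂(bondPercolation G q) := by
  have hS : MeasurableSet {x : BondConfig V × (BondConfig V × BondConfig V) |
      x.1 ∈ A ∧ resample (x.2.2 ∩ W) (x.1, x.2.1) ∈ B} :=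
    (measurable_fst hAm).inter (measurable_resample_inter W hBm)
  have hT : ∀ M : BondConfig V,
      MeasurableSet {x : BondConfig V × BondConfig V | x.1 ∈ A ∧ resample (M ∩ W) x ∈ B} := fun M =>
    (measurable_fst hAm).inter (measurable_resample _ hBm)
  rw [Measure.prod_apply_symm hS,
    lintegral_prod_symm _ (measurable_measure_prodMk_right hS).aemeasurable]
  refine lintegral_congr fun M => ?_
  rw [Measure.prod_apply_symm (hT M)]
  rfl

/-- **Noise keeps the Harris sign (general graph)**: for increasing measurable `A, B`, a finite
window `W` and any noise level `q`,
`P_p(A) P_p(B) ≤ (P_p ⊗ (P_p ⊗ P_q)){ω ∈ A ∧ resample (M ∩ W) (ω, ω') ∈ B}`. -/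
theorem measureReal_mul_le_measureReal_prod_noised (W : Finset (Sym2 V)) {A B : Set (BondConfig V)}
    (hA : IsUpperSet A) (hB : IsUpperSet B) (hAm : MeasurableSet A) (hBm : MeasurableSet B) :
    (bondPercolation G p).real A * (bondPercolation G p).real B ≤
      ((bondPercolation G p).prod ((bondPercolation G p).prod (bondPercolation G q))).real
        {x : BondConfig V × (BondConfig V × BondConfig V) |
          x.1 ∈ A ∧ resample (x.2.2 ∩ (↑W : Set (Sym2 V))) (x.1, x.2.1) ∈ B} := by
  have hK : ∀ M : BondConfig V,
      ENNReal.ofReal ((bondPercolation G p).real A * (bondPercolation G p).real B) ≤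
        (bondPercolation G p).prod (bondPercolation G p)
          {x : BondConfig V × BondConfig V | x.1 ∈ A ∧ resample (M ∩ (↑W : Set (Sym2 V))) x ∈ B} := by
    intro M
    have hfin : (M ∩ (↑W : Set (Sym2 V))).Finite := W.finite_toSet.inter_of_right M
    have h := measureReal_mul_le_measureReal_prod_resample G p hfin.toFinset hA hB hAm hBm
    rw [Set.Finite.coe_toFinset] at h
    rw [← ofReal_measureReal (measure_ne_top _ _)]
    exact ENNReal.ofReal_le_ofReal h
  have hle : ENNReal.ofReal ((bondPercolation G p).real A * (bondPercolation G p).real B) ≤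
      (bondPercolation G p).prod ((bondPercolation G p).prod (bondPercolation G q))
        {x : BondConfig V × (BondConfig V × BondConfig V) |
          x.1 ∈ A ∧ resample (x.2.2 ∩ (↑W : Set (Sym2 V))) (x.1, x.2.1) ∈ B} := by
    rw [measure_prod_mem_and_noised_mem_eq_lintegral G p q (↑W) hAm hBm]
    calc ENNReal.ofReal ((bondPercolation G p).real A * (bondPercolation G p).real B)
        = ∫⁻ _M, ENNReal.ofReal ((bondPercolation G p).real A * (bondPercolation G p).real B)
            ∂(bondPercolation G q) := by
          rw [lintegral_const, measure_univ, mul_one]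
      _ ≤ _ := lintegral_mono fun M => hK M
  rw [measureReal_def]
  exact (ENNReal.ofReal_le_iff_le_toReal (measure_ne_top _ _)).1 hle

end General

/-- **stub_noiseHarris** (N; registered stub of line `noise_bridges`, crux stmt-CriticalPhenomena-7799,
exact registered signature) — noise keeps the Harris sign: for every `r` and every noise level `t`,
`τ(0, a_r) τ(b_r, c_r) ≤ (P ⊗ (P ⊗ P_t)){ω ∈ {0 ↔ a_r} ∧ ω_t ∈ {b_r ↔ c_r}}`, where
`ω_t = resample (M ∩ armEdges (2r) 0) (ω, ω')`.  Instance of `measureReal_mul_le_measureReal_prod_noised`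
at `G = zdGraph 3`, `p = p_c`, `q = t` (`tau_def`, `isUpperSet_openConn`, `measurableSet_openConn_holds`). -/
theorem stub_noiseHarris :
    ∀ (r : ℕ) (t : unitInterval),
      tau 3 (criticalProbI 3) 0 ![(r : ℤ), (r : ℤ), 0] * tau 3 (criticalProbI 3) ![(r : ℤ), 0, (r : ℤ)] ![0, (r : ℤ), (r : ℤ)] ≤
        ((bondPercolation (zdGraph 3) (criticalProbI 3)).prod ((bondPercolation (zdGraph 3) (criticalProbI 3)).prod (bondPercolation (zdGraph 3) t))).real {x : BondConfig (Site 3) × (BondConfig (Site 3) × BondConfig (Site 3)) | x.1 ∈ openConn (0 : Site 3) ![(r : ℤ), (r : ℤ), 0] ∧ resample (x.2.2 ∩ (↑(armEdges (2 * r) (0 : Site 3)) : Set (Sym2 (Site 3)))) (x.1, x.2.1) ∈ openConn ![(r : ℤ), 0, (r : ℤ)] ![0, (r : ℤ), (r : ℤ)]} := by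
  intro r t
  rw [tau_def, tau_def]
  exact measureReal_mul_le_measureReal_prod_noised (zdGraph 3) (criticalProbI 3) t
    (armEdges (2 * r) (0 : Site 3)) (isUpperSet_openConn _ _) (isUpperSet_openConn _ _)
    (measurableSet_openConn_holds _ _) (measurableSet_openConn_holds _ _)

end Summit.CriticalPhenomena.PercolationContinuityZ3.Theorems.TetrahedronHarrisGap

end
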